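import Literature.AnabelianGeometry.SemiGraphs.ArithLevelData
import HarnessLib

/-!
# [SemiAnbd] Thm 5.4: the arithmetic level data in COMPACT / IMAGE form — `ArithLevelDataCpt` (exit (A54)
# of advisory F-t6g3-1, weakest shape (AI4″)) and the forgetful map `ArithLevelData.toCpt`

Mochizuki, *Semi-graphs of anabelioids*, Publ. RIMS **42** (2006), §5 pp. 62–66 (Def 5.1 (i), p. 65,
Thm 5.4 (i) p. 66: "entirely similar to … Theorem 3.7 (iii)", p. 41, whose argument with the author's
Comments (6)(b) runs on a COMPACT subgroup `H` acting on the finite levels), kurims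
`paper:url-f33ace170ff4`. [cite: MochizukiSemiAnbd2006, Thm 5.4 (i), p. 66]

STATEMENTS file of sub-DAG `plan/L3/SUBDAG-SemiAnbd-Thm54.md` (abc-iut-w4-d053, owner of the hypothesis
package `ArithLevelData`, p414405), answering abc-iut-L3-t6's ADVISORY F-t6g3-1 (STATUS 2026-08-26
03:39:11Z) by its exit (A54), the same exit the geometric package took (v4 `stabBranchPairCpt`):

* WHY.  The field (AI4′) `ArithLevelData.stabBranchPair` quantifies over EVERY `g : Π^temp_𝔊` fixing a
  compatible finite-level branch-pair system.  When the finite levels `𝔾_j` are the (coset / orbit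
  graphs of a) Galois tower that is not cofinal, `K∞ := ⋂ⱼ ker (levelAct j)` fixes every such system,
  so (AI4′) would force `K∞ ∩ ι(Π^temp_𝔾)` into a conjugate of the compact `ι(Π_b)` — false for a
  lazy tower containing a nontrivial deck translation (abc-iut-L3-t6's `F ⋊ C₂` loop model; kernel form
  `FiniteLevelData.eq_one_of_levelAct_eq_one`, p418229).  Print is unaffected: the proof of Thm 5.4 (i)
  moves only a COMPACT arithmetically ample `H`.
* WHAT.  `ArithLevelDataCpt 𝔾 D aug baseAct` — the fields of `ArithLevelData` verbatim, except
  (AI4′) ↦ (AI4″) `stabBranchPairAug : ∀ C, IsCompact C → … → (∀ i, ∀ g ∈ C, g fixes (w i, β i, β' i)) →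
  ∃ v b b' (a : Π_A) h, … ∧ aug(C) ≤ a · aug(Π_b ∩ h Π_{b'} h⁻¹) · a⁻¹` — the WEAKEST of the three
  forms (it is implied by (AI4′) and by the compact form (AI4′)_cpt: abc-iut-w4-d059's bridges
  `augDict_of_dict` / `augDict_of_cptDict`), the one print uses (non-ampleness of the image only), and the
  one the consumer meets (`hstar_of_isArithAmple_of_augDict`, ArithEstrangementNoBranchPairAug.lean);
  the forgetful `ArithLevelData.toCpt`; and the two derived binders `trans_act_vertexMap`, `noSwap` (as
  for `ArithLevelData`).  PRODUCER CAVEAT (abc-iut-L3-t6 / w4-d059): even (AI4″) fails over an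
  arithmetically LAZY tower; the finite levels must be arithmetically cofinal on compacta.  The Thm 5.4
  (i)(ii) assembly over this package (twin of ArithLevelDataThm54.lean) and the packaging constructor for
  the chart-produced data (twin of `ArithLevelData.ofChartTreeData`) follow in proof / definition
  companions.

A HYPOTHESIS PACKAGE (binders; nothing asserted, no instance beyond the bundled order/finiteness
attributes, no new named fact).  Nothing here asserts a statement of the paper; typed ≠ proved; no side
taken on [IUTchIII] Cor 3.12.
-/

namespace Literature.AnabelianGeometry.SemiGraphs

open CategoryTheory Topology
open scoped Pointwise

universe v u u' u''

/-! ### (S2a)_cpt Arithmetic level data, compact form -/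

/-- **Arithmetic level data for [SemiAnbd] Thm 5.4, compact/image form (AI4″)** (advisory F-t6g3-1 of
abc-iut-L3-t6, exit (A54)): the hypothesis package `ArithLevelData` (ArithLevelData.lean) VERBATIM except
that the branch-pair dictionary (AI4′) `stabBranchPair` — "EVERY `g ∈ Π^temp_𝔊` fixing a compatible
finite-level branch-pair system lies in a conjugate of `Π_b ∩ h Π_{b'} h⁻¹`" — is replaced by its
weakening (AI4″) `stabBranchPairAug` — COMPACT subgroups `C` fixing such a system, conclusion on the IMAGE in
`Π_A` (abc-iut-w4-d059's `hdictA`, ArithEstrangementNoBranchPairAug.lean): the `∀ g` form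
is not dischargeable when the finite levels `𝔾_j` are drawn from a non-cofinal Galois tower (the
elements of `⋂ⱼ ker (levelAct j)` fix every finite-level system and need not lie in any compact
subgroup — abc-iut-L3-t6's kernel witness `FiniteLevelData.eq_one_of_levelAct_eq_one` and lazy
`F ⋊ C₂` loop model), whereas the proof of Thm 5.4 (i) (p. 66 with p. 41 and the author's Comments
(6)(b)) only ever moves a COMPACT arithmetically ample `H`.  All other fields (L0)(L1)(AI1)–(AI3) are
byte-identical in meaning; `ArithLevelData.toCpt` forgets the stronger package to this one.  A HYPOTHESIS
PACKAGE: nothing is asserted; producing it is row T54-B (plan/GAP-LEDGER.md G-w4d053-1).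
[cite: MochizukiSemiAnbd2006, Thm 5.4 (i), p. 66] -/
structure ArithLevelDataCpt {Gtp : Type u'} [Group Gtp] [TopologicalSpace Gtp] {PA : Type u''} [Group PA]
    (𝔾 : SemiGraph.{u}) (D : DecompositionData Gtp 𝔾.Vertex 𝔾.Branch) (aug : Gtp →* PA)
    (baseAct : PA →* Aut 𝔾) : Type (max (u + 1) u' (v + 1)) where
  /-- the index set of levels (a cofinal system of finite étale Galois coverings `𝔊_j → 𝔊`) -/
  J : Type v
  [preorder : Preorder J]
  [isDirected : IsDirectedOrder J]
  [nonempty : Nonempty J]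
  /-- the trees `T_j` (universal graph-coverings of the finite levels) -/
  tree : J → SemiGraph.{u}
  /-- each `T_j` is a tree -/
  isTree : ∀ j, (tree j).IsTree
  /-- each `T_j` has a vertex -/
  vertex : ∀ j, (tree j).Vertex
  /-- the structure morphisms `T_j → 𝔾` -/
  proj : ∀ j, tree j ⟶ 𝔾
  /-- the actions `Π^temp_𝔊 → Aut T_j` -/
  act : ∀ j, Gtp →* Aut (tree j)
  /-- the actions factor through finite quotients: open kernels -/
  isOpen_ker : ∀ j, IsOpen ((act j).ker : Set Gtp)
  /-- (L1) the actions COVER the arithmetic action of `Π^temp_𝔊` on `𝔾` through `Π_A` (Def 5.1 (i)) -/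
  act_proj : ∀ (j : J) (g : Gtp), (act j g).hom ≫ proj j = proj j ≫ (baseAct (aug g)).hom
  /-- Thm 5.4, frame hypothesis: "the arithmetic actions on the underlying graphs … do not switch the
  branches of any edge" (for `baseAct`, t3's `NoBranchSwitching`) -/
  noSwitchBase : NoBranchSwitching 𝔾.edgeOf (fun (a : PA) (b : 𝔾.Branch) => (baseAct a).hom.branchMap b)
  /-- the transition morphisms `T_j → T_i`, `i ≤ j` -/
  trans : ∀ ⦃i j : J⦄, i ≤ j → (tree j ⟶ tree i)
  /-- functoriality: identities -/
  trans_id : ∀ j, trans (le_refl j) = 𝟙 (tree j)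
  /-- functoriality: composition -/
  trans_comp : ∀ ⦃i j k : J⦄ (hij : i ≤ j) (hjk : j ≤ k), trans hjk ≫ trans hij = trans (hij.trans hjk)
  /-- the transition morphisms are over `𝔾` -/
  trans_over : ∀ ⦃i j : J⦄ (h : i ≤ j), trans h ≫ proj i = proj j
  /-- the transition morphisms are equivariant -/
  trans_act : ∀ ⦃i j : J⦄ (h : i ≤ j) (g : Gtp), (act j g).hom ≫ trans h = trans h ≫ (act i g).hom
  /-- (AI1)+(AI2), two-sided: the verticial subgroups of `D` are exactly the stabilisers of compatible
  systems of tree vertices -/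
  fix : ∀ W : Subgroup Gtp, IsVerticial D W → ∃ x : ∀ j, (tree j).Vertex,
    (∀ ⦃i j : J⦄ (h : i ≤ j), (trans h).vertexMap (x j) = x i) ∧
      ∀ g : Gtp, g ∈ W ↔ ∀ j, (act j g).hom.vertexMap (x j) = x j
  /-- (AI2), two-sided (abc-iut-w4-d059's `hstab`, p413677): the full stabiliser of every compatible
  system of tree vertices IS a verticial subgroup of `D` -/
  stab : ∀ x : ∀ j, (tree j).Vertex, (∀ ⦃i j : J⦄ (h : i ≤ j), (trans h).vertexMap (x j) = x i) →
    ∃ W : Subgroup Gtp, IsVerticial D W ∧ ∀ g : Gtp, g ∈ W ↔ ∀ j, (act j g).hom.vertexMap (x j) = x j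
  /-- (AI3), two-sided: the stabiliser of an eventual compatible system of edges (with their branches)
  is an edge-like subgroup of `D` (the decomposition group of a branch IS such a stabiliser) -/
  edge : ∀ (j₁ : J) (ε : ∀ j : {j : J // j₁ ≤ j}, (tree j.1).Edge),
    (∀ ⦃i j : {j : J // j₁ ≤ j}⦄ (h : i.1 ≤ j.1), (trans h).edgeMap (ε j) = ε i) →
    ∃ L : Subgroup Gtp, IsEdgeLike D L ∧
      ∀ g : Gtp, g ∈ L ↔ ∀ j, (act j.1 g).hom.edgeMap (ε j) = ε j ∧
        ∀ b : (tree j.1).Branch, (tree j.1).edgeOf b = ε j → (act j.1 g).hom.branchMap b = b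
  /-- (AI3), converse direction (abc-iut-w4-d059's `hedgeFix`, p413677): every edge-like subgroup of `D`
  IS the full stabiliser of an eventual compatible system of tree edges (with their branches), given
  with its two compatible, level-wise distinct end-vertex systems -/
  edgeFix : ∀ L : Subgroup Gtp, IsEdgeLike D L →
    ∃ (i : J) (ε : ∀ j : {j : J // i ≤ j}, (tree j.1).Edge) (c c' : ∀ j : {j : J // i ≤ j}, (tree j.1).Branch)
      (x₁ x₂ : ∀ j, (tree j).Vertex),
      (∀ ⦃i' j : J⦄ (h : i' ≤ j), (trans h).vertexMap (x₁ j) = x₁ i') ∧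
      (∀ ⦃i' j : J⦄ (h : i' ≤ j), (trans h).vertexMap (x₂ j) = x₂ i') ∧
      (∀ j, x₁ j.1 ≠ x₂ j.1 ∧ (tree j.1).edgeOf (c j) = ε j ∧ (tree j.1).edgeOf (c' j) = ε j ∧
        (tree j.1).abuts (c j) = some (x₁ j.1) ∧ (tree j.1).abuts (c' j) = some (x₂ j.1)) ∧
      ∀ g : Gtp, g ∈ L ↔ ∀ j, (act j.1 g).hom.edgeMap (ε j) = ε j ∧
        ∀ b : (tree j.1).Branch, (tree j.1).edgeOf b = ε j → (act j.1 g).hom.branchMap b = b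
  /-- the finite semi-graphs `𝔾_j` underlying the finite étale Galois coverings `𝔊_j → 𝔊` -/
  level : J → SemiGraph.{u}
  [finiteVertex : ∀ j, Finite (level j).Vertex]
  [finiteBranch : ∀ j, Finite (level j).Branch]
  /-- the universal graph-coverings `T_j → 𝔾_j` -/
  quot : ∀ j, tree j ⟶ level j
  /-- graph-coverings are immersions -/
  quot_isImmersion : ∀ j, SemiGraph.IsImmersion (quot j)
  /-- the induced actions on the finite levels -/
  levelAct : ∀ j, Gtp →* Aut (level j)
  /-- `quot` is equivariant -/
  act_quot : ∀ (j : J) (g : Gtp), (act j g).hom ≫ quot j = quot j ≫ (levelAct j g).hom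
  /-- the transition morphisms `𝔾_j → 𝔾_i`, `i ≤ j` -/
  levelTrans : ∀ ⦃i j : J⦄, i ≤ j → (level j ⟶ level i)
  /-- functoriality: identities -/
  levelTrans_id : ∀ j, levelTrans (le_refl j) = 𝟙 (level j)
  /-- functoriality: composition -/
  levelTrans_comp : ∀ ⦃i j k : J⦄ (hij : i ≤ j) (hjk : j ≤ k),
    levelTrans hjk ≫ levelTrans hij = levelTrans (hij.trans hjk)
  /-- the finite-level transition morphisms are equivariant -/
  levelTrans_act : ∀ ⦃i j : J⦄ (h : i ≤ j) (g : Gtp),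
    (levelAct j g).hom ≫ levelTrans h = levelTrans h ≫ (levelAct i g).hom
  /-- the transition morphisms of the trees cover those of the finite levels -/
  trans_quot : ∀ ⦃i j : J⦄ (h : i ≤ j), trans h ≫ quot i = quot j ≫ levelTrans h
  /-- (AI4″) — Remark 2.2.1 at branch level, arithmetic twin, FOR COMPACT SUBGROUPS and IN IMAGE FORM
  (abc-iut-w4-d059's `hdictA` of ArithEstrangementNoBranchPairAug.lean verbatim; advisory F-t6g3-1, exit
  (A54) in its weakest form): a COMPACT subgroup `C ⊆ Π^temp_𝔊` fixing a compatible finite-level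
  branch-pair system has its IMAGE in `Π_A` inside a conjugate of the image of `Π_b ∩ h Π_{b'} h⁻¹`,
  `b, b'` abutting to one vertex `v`, `h ∈ Π_v`, `b' ≠ b ∨ h ∉ Π_b` — exactly what total arithmetic
  estrangement (non-ampleness of those images) contradicts for an arithmetically ample `C` -/
  stabBranchPairAug : ∀ (C : Subgroup Gtp), IsCompact (C : Set Gtp) →
    ∀ (j₀ : J) (w : ∀ i : {i : J // j₀ ≤ i}, (level i.1).Vertex)
    (β β' : ∀ i : {i : J // j₀ ≤ i}, (level i.1).Branch),
    (∀ i, β i ≠ β' i ∧ (level i.1).abuts (β i) = some (w i) ∧ (level i.1).abuts (β' i) = some (w i)) →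
    (∀ ⦃i i' : {i : J // j₀ ≤ i}⦄ (h : i.1 ≤ i'.1), (levelTrans h).vertexMap (w i') = w i ∧
      (levelTrans h).branchMap (β i') = β i ∧ (levelTrans h).branchMap (β' i') = β' i) →
    (∀ (i : {i : J // j₀ ≤ i}) (g : Gtp), g ∈ C → (levelAct i.1 g).hom.vertexMap (w i) = w i ∧
      (levelAct i.1 g).hom.branchMap (β i) = β i ∧ (levelAct i.1 g).hom.branchMap (β' i) = β' i) →
    ∃ (v : 𝔾.Vertex) (b b' : 𝔾.Branch) (a : PA) (h : Gtp), D.abut b = some v ∧ D.abut b' = some v ∧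
      h ∈ D.vertGp v ∧ (b' ≠ b ∨ h ∉ D.brGp b) ∧
      C.map aug ≤ conjSubgroup a ((D.brGp b ⊓ conjSubgroup h (D.brGp b')).map aug)

namespace ArithLevelDataCpt

attribute [instance] ArithLevelDataCpt.preorder ArithLevelDataCpt.isDirected ArithLevelDataCpt.nonempty
  ArithLevelDataCpt.finiteVertex ArithLevelDataCpt.finiteBranch

variable {Gtp : Type u'} [Group Gtp] [TopologicalSpace Gtp] {PA : Type u''} [Group PA]
  {𝔾 : SemiGraph.{u}} {D : DecompositionData Gtp 𝔾.Vertex 𝔾.Branch} {aug : Gtp →* PA}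
  {baseAct : PA →* Aut 𝔾}

/-- Pointwise equivariance of the tree transitions of a compact-form package (the binder `hequiv` of
abc-iut-w4-d059's T54-3 file). [cite: MochizukiSemiAnbd2006, Thm 5.4 (i), p. 66] -/
theorem trans_act_vertexMap (L : ArithLevelDataCpt.{v} 𝔾 D aug baseAct) ⦃i j : L.J⦄ (h : i ≤ j)
    (g : Gtp) (x : (L.tree j).Vertex) :
    (L.trans h).vertexMap ((L.act j g).hom.vertexMap x) =
      (L.act i g).hom.vertexMap ((L.trans h).vertexMap x) := by
  have := congrArg (fun φ : L.tree j ⟶ L.tree i => φ.vertexMap x) (L.trans_act h g)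
  simpa using this

/-- **No branch switching at tree level, DERIVED** from the printed hypothesis on the base graph
(`noSwitchBase`) and `act_proj`, exactly as `ArithLevelData.noSwap`.
[cite: MochizukiSemiAnbd2006, Thm 5.4, p. 66] -/
theorem noSwap (L : ArithLevelDataCpt.{v} 𝔾 D aug baseAct) (j : L.J) (g : Gtp)
    (b' : (L.tree j).Branch)
    (he : (L.act j g).hom.edgeMap ((L.tree j).edgeOf b') = (L.tree j).edgeOf b') :
    (L.act j g).hom.branchMap b' = b' := by
  have hedge : (L.tree j).edgeOf ((L.act j g).hom.branchMap b') = (L.tree j).edgeOf b' := by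
    rw [(L.act j g).hom.edgeOf_branchMap, he]
  have hproj : (L.proj j).branchMap ((L.act j g).hom.branchMap b') =
      (baseAct (aug g)).hom.branchMap ((L.proj j).branchMap b') := by
    have := congrArg (fun φ : L.tree j ⟶ 𝔾 => φ.branchMap b') (L.act_proj j g)
    simpa using this
  have hbase : (baseAct (aug g)).hom.branchMap ((L.proj j).branchMap b') = (L.proj j).branchMap b' := by
    apply L.noSwitchBase (aug g)
    change 𝔾.edgeOf ((baseAct (aug g)).hom.branchMap ((L.proj j).branchMap b')) =
      𝔾.edgeOf ((L.proj j).branchMap b')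
    rw [← hproj, (L.proj j).edgeOf_branchMap, (L.proj j).edgeOf_branchMap, hedge]
  exact (L.proj j).branchMap_injOn _ _ hedge (by rw [hproj, hbase])

end ArithLevelDataCpt

/-! ### The forgetful map: the `∀ g` package gives the compact package -/

namespace ArithLevelData

variable {Gtp : Type u'} [Group Gtp] [TopologicalSpace Gtp] {PA : Type u''} [Group PA]
  {𝔾 : SemiGraph.{u}} {D : DecompositionData Gtp 𝔾.Vertex 𝔾.Branch} {aug : Gtp →* PA}
  {baseAct : PA →* Aut 𝔾}

/-- **Forgetting (AI4′) to (AI4″)**: arithmetic level data in the `∀ g` form give arithmetic level data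
in the compact/image form (all other fields unchanged; `a := aug x`). [cite: MochizukiSemiAnbd2006, Thm 5.4 (i), p. 66] -/
def toCpt (L : ArithLevelData.{v} 𝔾 D aug baseAct) : ArithLevelDataCpt.{v} 𝔾 D aug baseAct where
  J := L.J
  tree := L.tree
  isTree := L.isTree
  vertex := L.vertex
  proj := L.proj
  act := L.act
  isOpen_ker := L.isOpen_ker
  act_proj := L.act_proj
  noSwitchBase := L.noSwitchBase
  trans := L.trans
  trans_id := L.trans_id
  trans_comp := L.trans_comp
  trans_over := L.trans_over
  trans_act := L.trans_act
  fix := L.fix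
  stab := L.stab
  edge := L.edge
  edgeFix := L.edgeFix
  level := L.level
  quot := L.quot
  quot_isImmersion := L.quot_isImmersion
  levelAct := L.levelAct
  act_quot := L.act_quot
  levelTrans := L.levelTrans
  levelTrans_id := L.levelTrans_id
  levelTrans_comp := L.levelTrans_comp
  levelTrans_act := L.levelTrans_act
  trans_quot := L.trans_quot
  stabBranchPairAug C _ j₀ w β β' hββ hcompat hfix := by
    obtain ⟨v, b, b', x, h, hb, hb', hh, hbb, hstab⟩ := L.stabBranchPair j₀ w β β' hββ hcompat
    refine ⟨v, b, b', aug x, h, hb, hb', hh, hbb, ?_⟩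
    rintro _ ⟨g, hg, rfl⟩
    obtain ⟨k, hk, hkg⟩ := hstab g (fun i => hfix i g hg)
    refine ⟨aug k, ⟨k, hk, rfl⟩, ?_⟩
    rw [← hkg]
    simp only [MulEquiv.coe_toMonoidHom, MulAut.conj_apply, map_mul, map_inv]

end ArithLevelData

end Literature.AnabelianGeometry.SemiGraphs
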